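import Summits.QuantumFields.YangMills.Theorems.WeakCouplingRatesCurrency
import HarnessLib

/-!
# Route `SourcedPressureJensen`, crux `SourcedPressureDecoupling` (KS2″, stmt-QuantumFields-24296): DEFINITIONS of the line
# «ENTROPIC-SEAM» skeleton (planner ym-idea-3 g2, `bc/line2/SourcedPressureDecoupling_birth_w.lean`)

The objects of the registered stubs `stub_chain / stub_seam / stub_crude / stub_window / stub_count`, VERBATIM from the birth
skeleton (namespace `Summit.QuantumFields.YangMills.Cruxes.SourcedPressureDecoupling.EntropicSeam`), filed once so that stub files can
import them instead of re-declaring them (torus of side `L+1`; tiling by `q⁴` cells, `q = (L+1)/(ℓ+1)`, cell `a + [0,ℓ]⁴`; the rest =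
slabs):

* `mT r β L`            — `m_T = β·E_{β,L+1}[c₁₂]`, the torus plaquette mean (KS's centring constant);
* `incrT r β h n L`      — KS's per-site sourced-pressure increment on the torus (source `−h Σ_x H_x`, centring `m_T`);
* `freeCell r β t m n ℓ L` — the per-site sourced increment of the FREE-b.c. cell `[0,ℓ]⁴` inside the torus (density `e^{+β S_out}`),
  source strength `t`, centring `m` (the object of `ColdBoxSourcedPressure`, KS1″);
* `seamMoment r β ℓ L`   — `|T|⁻¹ log E_T exp(+β S_seam)`, `S_seam` = Wilson cost of every plaquette NOT inside a cell of the tiling;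
* `intCard n ℓ L`        — number of pairs `(x, x+ne₀)` interior to the cells; `cellCount ℓ L = q⁴(ℓ+1)⁴`.

Definitions only (no theorem); Literature-side imports only (`WeakCouplingRatesCurrency` for `plaqCost0`).  RECORD-label rung
(route target `XiPow` = an upper bound on the lattice gap); the Yang–Mills mass gap is NOT proved by anything here.
-/

set_option autoImplicit false

namespace Summit.QuantumFields.YangMills.Cruxes.SourcedPressureDecoupling.EntropicSeam

open Literature.MathematicalPhysics.QuantumFieldTheory Literature.MathematicalPhysics.QuantumLattice
  Summit.QuantumFields.YangMills.Theorems.WeakCouplingRates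

section Defs
variable {G : Type} [Group G] [TopologicalSpace G] [IsTopologicalGroup G] [CompactSpace G] [MeasurableSpace G] [BorelSpace G]

/-- `m_T = β·E_(β,L+1)[c]`, the torus plaquette mean (KS's centring constant). -/
noncomputable def mT (r : LatticeRep G) (β : ℝ) (L : ℕ) : ℝ :=
  β * wilsonExpectation (L := L + 1) r.ρ β (toTorusObservable (L + 1) (plaqCost0 (d := 4) r.ρ 1 2))

/-- KS's per-site sourced-pressure increment on the torus of side `L+1` (verbatim body of `SourcedPressureIncrement`). -/
noncomputable def incrT (r : LatticeRep G) (β h : ℝ) (n L : ℕ) : ℝ :=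
  ((L + 1 : ℝ) ^ 4)⁻¹ * Real.log (wilsonExpectation (L := L + 1) r.ρ β fun U => Real.exp (-h * ∑ x : Fin 4 → Fin (L + 1), toTorusObservable (L + 1) (fun V => (β * plaqCost0 (d := 4) r.ρ 1 2 (configShift (fun i => -((x i : ℕ) : ℤ)) V) - β * wilsonExpectation (L := L + 1) r.ρ β (toTorusObservable (L + 1) (plaqCost0 (d := 4) r.ρ 1 2))) * (β * plaqCost0 (d := 4) r.ρ 1 2 (timeShiftLG (G := G) n (configShift (fun i => -((x i : ℕ) : ℤ)) V)) - β * wilsonExpectation (L := L + 1) r.ρ β (toTorusObservable (L + 1) (plaqCost0 (d := 4) r.ρ 1 2)))) U))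

/-- The per-site sourced increment of the free-b.c. cell `[0,ℓ]⁴` inside the torus of side `L+1`, source strength `t`, centring `m`
(verbatim body of the restated `ColdBoxSourcedPressure`). -/
noncomputable def freeCell (r : LatticeRep G) (β t m : ℝ) (n ℓ L : ℕ) : ℝ :=
  ((ℓ + 1 : ℝ) ^ 4)⁻¹ * Real.log (wilsonExpectation (L := L + 1) r.ρ β (fun U => Real.exp (-(t) * (∑ x : Fin 4 → Fin (L + 1), if ((∀ k : Fin 4, ((x k : ℕ)) ≤ ℓ) ∧ ((x 1 : ℕ)) + 1 ≤ ℓ ∧ ((x 2 : ℕ)) + 1 ≤ ℓ ∧ ((x 0 : ℕ)) + n ≤ ℓ) then toTorusObservable (L + 1) (fun V => (β * plaqCost0 (d := 4) r.ρ 1 2 (configShift (fun k => -((x k : ℕ) : ℤ)) V) - m) * (β * plaqCost0 (d := 4) r.ρ 1 2 (timeShiftLG (G := G) n (configShift (fun k => -((x k : ℕ) : ℤ)) V)) - m)) U else 0)) * Real.exp (β * (∑ x : Fin 4 → Fin (L + 1), ∑ i : Fin 4, ∑ j : Fin 4, if i < j ∧ ¬ ((∀ k : Fin 4, ((x k : ℕ))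 ≤ ℓ) ∧ ((x i : ℕ)) + 1 ≤ ℓ ∧ ((x j : ℕ)) + 1 ≤ ℓ) then toTorusObservable (L + 1) (fun V => plaqCost0 (d := 4) r.ρ i j (configShift (fun k => -((x k : ℕ) : ℤ)) V)) U else 0))) / wilsonExpectation (L := L + 1) r.ρ β (fun U => Real.exp (β * (∑ x : Fin 4 → Fin (L + 1), ∑ i : Fin 4, ∑ j : Fin 4, if i < j ∧ ¬ ((∀ k : Fin 4, ((x k : ℕ)) ≤ ℓ) ∧ ((x i : ℕ)) + 1 ≤ ℓ ∧ ((x j : ℕ)) + 1 ≤ ℓ) then toTorusObservable (L + 1) (fun V => plaqCost0 (d := 4) r.ρ i j (configShift (fun k => -((x k : ℕ) : ℤ)) V)) U else 0))))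

/-- `|T|⁻¹ log E_T exp(+β S_seam)`: the upward exponential moment of the seam energy of the tiling under the torus state. -/
noncomputable def seamMoment (r : LatticeRep G) (β : ℝ) (ℓ L : ℕ) : ℝ :=
  ((L + 1 : ℝ) ^ 4)⁻¹ * Real.log (wilsonExpectation (L := L + 1) r.ρ β (fun U => Real.exp (β * (∑ x : Fin 4 → Fin (L + 1), ∑ i : Fin 4, ∑ j : Fin 4, if i < j ∧ ¬ ((∀ k : Fin 4, ((x k : ℕ)) < ((L + 1) / (ℓ + 1)) * (ℓ + 1)) ∧ ((x i : ℕ)) % (ℓ + 1) ≠ ℓ ∧ ((x j : ℕ)) % (ℓ + 1) ≠ ℓ) then toTorusObservable (L + 1) (fun V => plaqCost0 (d := 4) r.ρ i j (configShift (fun k => -((x k : ℕ) : ℤ)) V)) U else 0))))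

end Defs

/-- Number of pairs `(x, x + n e₀)` of `(1,2)`-plaquettes interior to one cell of the tiling. -/
def intCard (n ℓ L : ℕ) : ℕ :=
  (Finset.univ.filter (fun x : Fin 4 → Fin (L + 1) => ((∀ k : Fin 4, ((x k : ℕ)) < ((L + 1) / (ℓ + 1)) * (ℓ + 1)) ∧ ((x 1 : ℕ)) % (ℓ + 1) ≠ ℓ ∧ ((x 2 : ℕ)) % (ℓ + 1) ≠ ℓ ∧ ((x 0 : ℕ)) % (ℓ + 1) + n ≤ ℓ))).card

/-- Number of sites covered by the cells of the tiling, `q⁴ (ℓ+1)⁴`. -/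
def cellCount (ℓ L : ℕ) : ℕ :=
  ((L + 1) / (ℓ + 1)) ^ 4 * (ℓ + 1) ^ 4


end Summit.QuantumFields.YangMills.Cruxes.SourcedPressureDecoupling.EntropicSeam
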